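import Literature.Analysis.OperatorTheory.YangMillsMatrixModelAgmonWeights
import Literature.Analysis.OperatorTheory.YangMillsMatrixModelDiscreteness
import HarnessLib

/-!
# Weighted Caccioppoli inequality for Lüscher's matrix-model Hamiltonian: exponential `L²` decay PROPAGATES from
# `F` and `𝔥F − EF` to the gradient `∇F`

Topic `Literature/Analysis/OperatorTheory`; decay step (N5) of the formalisation of the named fact
`LuscherHamiltonianEigenfunctions` (AL1).  Vocabulary of `YangMillsMatrixModelDiscreteSpectrum.lean` (`ZM = ℝ⁹`, `𝔮 = energyForm`,
`V = luscherPotential ≥ 0`, `IsTestFn = C²_c`), `…ValleyBound.lean` (`pderiv`, `norm_gradient_sq`), `…Eigenfunctions.lean` (`hApply = 𝔥`),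
`…CutoffEnergy.lean` (Agmon's localisation identity `energyForm_testFn_mul`: `𝔮(χF) = ∫χ²F·𝔥F + ½∫‖∇χ‖²F²`) and
`…AgmonWeights.lean` (weighted radial cut-offs `χ = χ_R · e^{φ(⟨x⟩)}`, `|φ'| ≤ L`).

**Main result** (`integrable_weight_sq_mul_pderiv_sq`, Agmon 1982 Thm. 1.5 in Caccioppoli form; Gilbarg–Trudinger (8.7)-type energy
estimate with weights).  Let `F ∈ C²(ℝ⁹)` solve `𝔥F = E F + r` pointwise with `r` continuous, and let `w = e^{φ(⟨x⟩)}` be a radial weight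
with `|φ'| ≤ L`.  If `w²F²` and `w²r²` are integrable, then so is `w²(∂_pF)²` for every coordinate `p`:

  `¼∫χ²‖∇F‖² ≤ E∫χ²F² + ∫χ²F r + ∫‖∇χ‖²F²`   (`χ = χ_R w`, from the localisation identity, `V ≥ 0` and `(u+v)² ≥ ½v² − u²`),

the right side is bounded by `(|E| + ½ + 2M₁ + 2L²)∫w²F² + ½∫w²r²` uniformly in `R`, and `χ = w` on the ball `‖x‖ < R`; monotone
exhaustion by balls (`integrable_of_forall_setIntegral_ball_le`) concludes.  No lower bound on `V` beyond `V ≥ 0` is used here — the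
valley bound enters only in the base step (`YangMillsMatrixModelAgmonBase.lean`), which creates the decay of an `L²` eigenfunction.

All proved; no definitions, no named facts.

## References
* [Agmon1982] S. Agmon, *Lectures on Exponential Decay…*, Princeton Math. Notes 29 (1982), Thm. 1.5, (1.16)–(1.16″).
* [GilbargTrudinger2001] D. Gilbarg, N. Trudinger, *Elliptic PDE of Second Order*, §8.3 (energy/Caccioppoli estimates).
-/

noncomputable section

open MeasureTheory Filter Topology Function Metric
open scoped BigOperators ENNReal

namespace Literature.Analysis.OperatorTheory.YMMatrixModel

/-! ### 1. Exhaustion by balls: integrability from uniform bounds on `∫_{‖x‖<R}` -/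

/-- **Monotone exhaustion**: a nonnegative continuous function on `ℝ⁹` whose integrals over the balls `‖x‖ < R` (`R ≥ 1`) are
bounded by `K` is integrable, with `∫ g ≤ K`. [cite: Agmon1982, Thm. 1.5 (proof)] -/
theorem integrable_of_forall_setIntegral_ball_le {g : ZM → ℝ} (hg : Continuous g) (hg0 : ∀ x, 0 ≤ g x) {K : ℝ}
    (h : ∀ R : ℝ, 1 ≤ R → ∫ x in ball (0 : ZM) R, g x ≤ K) :
    Integrable g ∧ ∫ x, g x ≤ K := by
  have hK : 0 ≤ K := le_trans (setIntegral_nonneg measurableSet_ball fun x _ => hg0 x) (h 1 le_rfl)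
  have hloc : ∀ R : ℝ, IntegrableOn g (ball (0 : ZM) R) := fun R =>
    (hg.continuousOn.integrableOn_compact (isCompact_closedBall (0 : ZM) R)).mono_set ball_subset_closedBall
  have hmeas : AEStronglyMeasurable g volume := hg.aestronglyMeasurable
  -- the lintegral over `univ` as a supremum over balls
  have hdir : Directed (· ⊆ ·) fun n : ℕ => ball (0 : ZM) ((n : ℝ) + 1) := by
    refine Monotone.directed_le fun m n hmn => ball_subset_ball ?_
    exact_mod_cast Nat.succ_le_succ hmn
  have hunion : (⋃ n : ℕ, ball (0 : ZM) ((n : ℝ) + 1)) = Set.univ := iUnion_ball_nat_succ 0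
  have hlin : ∫⁻ x, ENNReal.ofReal (g x) = ⨆ n : ℕ, ∫⁻ x in ball (0 : ZM) ((n : ℝ) + 1), ENNReal.ofReal (g x) := by
    rw [← setLIntegral_iUnion_of_directed _ hdir, hunion, Measure.restrict_univ]
  have hle : ∫⁻ x, ENNReal.ofReal (g x) ≤ ENNReal.ofReal K := by
    rw [hlin]
    refine iSup_le fun n => ?_
    rw [← ofReal_integral_eq_lintegral_ofReal (hloc _) (ae_of_all _ fun x => hg0 x)]
    exact ENNReal.ofReal_le_ofReal (h _ (by have : (0 : ℝ) ≤ n := n.cast_nonneg; linarith))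
  have hfin : HasFiniteIntegral g volume := by
    rw [hasFiniteIntegral_iff_enorm]
    have e : (fun x => ‖g x‖ₑ) = fun x => ENNReal.ofReal (g x) := by
      funext x; rw [Real.enorm_eq_ofReal (hg0 x)]
    rw [e]
    exact lt_of_le_of_lt hle ENNReal.ofReal_lt_top
  have hint : Integrable g := ⟨hmeas, hfin⟩
  refine ⟨hint, ?_⟩
  rw [integral_eq_lintegral_of_nonneg_ae (ae_of_all _ fun x => hg0 x) hmeas]
  exact ENNReal.toReal_le_of_le_ofReal hK hle

/-! ### 2. The localisation identity read through the equation `𝔥F = EF + r`, and the kinetic lower bound -/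

section Caccioppoli

variable {F r χ : ZM → ℝ} {E : ℝ}

/-- The localisation identity for a solution of `𝔥F = E F + r`: `𝔮(χF) = E∫χ²F² + ∫χ²F r + ½∫‖∇χ‖²F²`.
[cite: Agmon1982, (1.16″)] -/
theorem energyForm_cutoff_mul_of_eq (hχ : IsTestFn χ) (hF : ContDiff ℝ 2 F) (hr : Continuous r)
    (heq : ∀ x, hApply F x = E * F x + r x) :
    energyForm (χ * F) = E * (∫ x, χ x ^ 2 * F x ^ 2) + (∫ x, χ x ^ 2 * (F x * r x)) +
      (1 / 2 : ℝ) * ∫ x, ‖gradient χ x‖ ^ 2 * F x ^ 2 := by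
  rw [energyForm_testFn_mul hχ hF]
  have hpt : ∀ x, χ x ^ 2 * (F x * (-(1 / 2 : ℝ) * (∑ p, pderiv p (pderiv p F) x) + luscherPotential x * F x)) =
      E * (χ x ^ 2 * F x ^ 2) + χ x ^ 2 * (F x * r x) := by
    intro x
    have h := heq x
    rw [hApply_def, laplacian_def] at h
    rw [h]; ring
  rw [integral_congr_ae (Eventually.of_forall hpt)]
  have I1 : Integrable fun x => χ x ^ 2 * F x ^ 2 := by
    have := (hχ.mul_contDiff hF).integrable_sq
    exact this.congr (Eventually.of_forall fun x => by simp [mul_pow])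
  have I2 : Integrable fun x => χ x ^ 2 * (F x * r x) :=
    (((hχ.continuous.pow 2).mul (hF.continuous.mul hr)).integrable_of_hasCompactSupport
      ((hχ.hasCompactSupport_sq).mul_right))
  rw [integral_add (I1.const_mul E) I2, integral_const_mul]

/-- Pointwise kinetic lower bound: `½‖∇(χF)‖² + V(χF)² ≥ ¼χ²‖∇F‖² − ½F²‖∇χ‖²` (from `V ≥ 0` and `(u+v)² ≥ ½v² − u²`).
[cite: GilbargTrudinger2001, §8.3] -/
theorem energyIntegrand_mul_ge (hχ : IsTestFn χ) (hF : ContDiff ℝ 2 F) (x : ZM) :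
    (1 / 4 : ℝ) * (χ x ^ 2 * ‖gradient F x‖ ^ 2) - (1 / 2 : ℝ) * (‖gradient χ x‖ ^ 2 * F x ^ 2) ≤
      (1 / 2 : ℝ) * ‖gradient (χ * F) x‖ ^ 2 + luscherPotential x * (χ * F) x ^ 2 := by
  have hV : 0 ≤ luscherPotential x * (χ * F) x ^ 2 := mul_nonneg (luscherPotential_nonneg x) (sq_nonneg _)
  rw [norm_gradient_sq, norm_gradient_sq, norm_gradient_sq]
  have hχd := hχ.differentiable
  have hFd : Differentiable ℝ F := hF.differentiable (by norm_num)
  have hpt : ∀ p, (1 / 4 : ℝ) * (χ x ^ 2 * (pderiv p F x) ^ 2) - (1 / 2 : ℝ) * ((pderiv p χ x) ^ 2 * F x ^ 2) ≤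
      (1 / 2 : ℝ) * (pderiv p (χ * F) x) ^ 2 := by
    intro p
    rw [pderiv_mul hχd hFd p x]
    nlinarith [sq_nonneg (2 * (pderiv p χ x * F x) + χ x * pderiv p F x)]
  have hsum := Finset.sum_le_sum fun p (_ : p ∈ Finset.univ) => hpt p
  have e1 : ∑ p, ((1 / 4 : ℝ) * (χ x ^ 2 * (pderiv p F x) ^ 2) - (1 / 2 : ℝ) * ((pderiv p χ x) ^ 2 * F x ^ 2)) =
      (1 / 4 : ℝ) * (χ x ^ 2 * ∑ p, (pderiv p F x) ^ 2) - (1 / 2 : ℝ) * ((∑ p, (pderiv p χ x) ^ 2) * F x ^ 2) := by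
    rw [Finset.sum_sub_distrib, Finset.mul_sum, Finset.mul_sum, Finset.sum_mul, Finset.mul_sum]
  have e2 : ∑ p, (1 / 2 : ℝ) * (pderiv p (χ * F) x) ^ 2 = (1 / 2 : ℝ) * ∑ p, (pderiv p (χ * F) x) ^ 2 := by
    rw [Finset.mul_sum]
  rw [e1, e2] at hsum
  linarith

/-- **The Caccioppoli inequality with a cut-off**: for `χ ∈ C²_c`, `F ∈ C²` with `𝔥F = EF + r`,
`¼∫χ²‖∇F‖² ≤ E∫χ²F² + ∫χ²F r + ∫‖∇χ‖²F²`. [cite: GilbargTrudinger2001, §8.3] [cite: Agmon1982, Thm. 1.5] -/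
theorem quarter_integral_cutoff_gradient_le (hχ : IsTestFn χ) (hF : ContDiff ℝ 2 F) (hr : Continuous r)
    (heq : ∀ x, hApply F x = E * F x + r x) :
    (1 / 4 : ℝ) * ∫ x, χ x ^ 2 * ‖gradient F x‖ ^ 2 ≤
      E * (∫ x, χ x ^ 2 * F x ^ 2) + (∫ x, χ x ^ 2 * (F x * r x)) + ∫ x, ‖gradient χ x‖ ^ 2 * F x ^ 2 := by
  have hψ : IsTestFn (χ * F) := hχ.mul_contDiff hF
  -- integrability
  have Ikin : Integrable fun x => (1 / 2 : ℝ) * ‖gradient (χ * F) x‖ ^ 2 := hψ.integrable_norm_gradient_sq.const_mul _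
  have Ipot : Integrable fun x => luscherPotential x * (χ * F) x ^ 2 := hψ.integrable_mul_sq continuous_luscherPotential
  have hgradFc : Continuous fun x => ‖gradient F x‖ ^ 2 := by
    have e : (fun x => ‖gradient F x‖ ^ 2) = fun x => ∑ p, (pderiv p F x) ^ 2 := by funext x; exact norm_gradient_sq F x
    rw [e]; exact continuous_finsetSum _ fun p _ => (continuous_pderiv_of_contDiff_two hF p).pow 2
  have hgradχc : Continuous fun x => ‖gradient χ x‖ ^ 2 := by
    have e : (fun x => ‖gradient χ x‖ ^ 2) = fun x => ∑ p, (pderiv p χ x) ^ 2 := by funext x; exact norm_gradient_sq χ x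
    rw [e]; exact continuous_finsetSum _ fun p _ => (hχ.continuous_pderiv p).pow 2
  have IA : Integrable fun x => χ x ^ 2 * ‖gradient F x‖ ^ 2 :=
    ((hχ.continuous.pow 2).mul hgradFc).integrable_of_hasCompactSupport hχ.hasCompactSupport_sq.mul_right
  have hgradχs : HasCompactSupport fun x => ‖gradient χ x‖ ^ 2 := by
    refine HasCompactSupport.intro hχ.2 fun x hx => ?_
    simp [norm_gradient_sq, pderiv_eq_zero_of_notMem_tsupport hx]
  have IB : Integrable fun x => ‖gradient χ x‖ ^ 2 * F x ^ 2 :=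
    (hgradχc.mul (hF.continuous.pow 2)).integrable_of_hasCompactSupport hgradχs.mul_right
  -- the lower bound on the energy
  have hlow : (1 / 4 : ℝ) * (∫ x, χ x ^ 2 * ‖gradient F x‖ ^ 2) - (1 / 2 : ℝ) * ∫ x, ‖gradient χ x‖ ^ 2 * F x ^ 2 ≤
      energyForm (χ * F) := by
    unfold energyForm
    rw [← integral_const_mul, ← integral_const_mul, ← integral_sub (IA.const_mul _) (IB.const_mul _)]
    exact integral_mono ((IA.const_mul _).sub (IB.const_mul _)) (Ikin.add Ipot) fun x => energyIntegrand_mul_ge hχ hF x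
  rw [energyForm_cutoff_mul_of_eq hχ hF hr heq] at hlow
  linarith

end Caccioppoli

/-! ### 3. Propagation of weighted `L²` decay to the gradient -/

section Propagate

variable {F r : ZM → ℝ} {E : ℝ} {φ : ℝ → ℝ} {L : ℝ}

set_option maxHeartbeats 400000 in
/-- ★ **Weighted Caccioppoli / Agmon propagation.**  Let `F ∈ C²(ℝ⁹)` solve `𝔥F = EF + r` (`r` continuous) and let
`w = e^{φ(⟨x⟩)}` with `φ ∈ C²`, `|φ'| ≤ L`.  If `w²F²` and `w²r²` are integrable then `w²(∂_pF)²` is integrable for every coordinate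
`p`, with `∫ w²(∂_pF)² ≤ (4|E| + 2 + 8M + 8L²)∫w²F² + 2∫w²r²` (`M` the gradient bound of the radial cut-off).
[cite: Agmon1982, Thm. 1.5] [cite: GilbargTrudinger2001, §8.3] -/
theorem integrable_weight_sq_mul_pderiv_sq (hF : ContDiff ℝ 2 F) (hr : Continuous r)
    (heq : ∀ x, hApply F x = E * F x + r x) (hφ : ContDiff ℝ 2 φ) (hL : ∀ t, |deriv φ t| ≤ L)
    (hFw : Integrable fun x : ZM => Real.exp (φ (Real.sqrt (1 + ‖x‖ ^ 2))) ^ 2 * F x ^ 2)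
    (hrw : Integrable fun x : ZM => Real.exp (φ (Real.sqrt (1 + ‖x‖ ^ 2))) ^ 2 * r x ^ 2) (p : Fin 3 × Fin 3) :
    Integrable fun x : ZM => Real.exp (φ (Real.sqrt (1 + ‖x‖ ^ 2))) ^ 2 * pderiv p F x ^ 2 := by
  obtain ⟨M, hM0, hpack⟩ := weightedCutoff_package hφ hL
  set w : ZM → ℝ := fun y => Real.exp (φ (Real.sqrt (1 + ‖y‖ ^ 2))) with hw_def
  set A : ℝ := ∫ x, w x ^ 2 * F x ^ 2 with hA_def
  set B : ℝ := ∫ x, w x ^ 2 * r x ^ 2 with hB_def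
  have hA0 : 0 ≤ A := integral_nonneg fun x => by positivity
  have hB0 : 0 ≤ B := integral_nonneg fun x => by positivity
  set K : ℝ := (4 * |E| + 2 + 8 * M + 8 * L ^ 2) * A + 2 * B with hK_def
  have hwc : Continuous w := (contDiff_weight hφ).continuous
  have hdFc : Continuous (pderiv p F) := continuous_pderiv_of_contDiff_two hF p
  -- the target function
  have hgc : Continuous fun x => w x ^ 2 * pderiv p F x ^ 2 := (hwc.pow 2).mul (hdFc.pow 2)
  refine (integrable_of_forall_setIntegral_ball_le hgc (fun x => by positivity) (K := K) fun R hR => ?_).1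
  obtain ⟨hχ, hχeq, hχ0, hχle, hχgrad, hgradR, -⟩ := hpack R hR
  set χ : ZM → ℝ := radialCutoff R * w with hχ_def
  -- Caccioppoli with this cut-off
  have hcac := quarter_integral_cutoff_gradient_le hχ hF hr heq
  -- pointwise comparisons `χ² ≤ w²`, `‖∇χ‖² ≤ (2M + 2L²) w²`
  have hχsq : ∀ x, χ x ^ 2 ≤ w x ^ 2 := fun x => pow_le_pow_left₀ (hχ0 x) (hχle x) 2
  have hgradχ : ∀ x, ‖gradient χ x‖ ^ 2 ≤ (2 * M + 2 * L ^ 2) * w x ^ 2 := fun x => by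
    have h1 := hχgrad x
    have h2 := hgradR x
    have h3 := hχsq x
    have hw2 : 0 ≤ w x ^ 2 := sq_nonneg _
    calc ‖gradient χ x‖ ^ 2 ≤ 2 * w x ^ 2 * ‖gradient (radialCutoff R) x‖ ^ 2 + 2 * L ^ 2 * χ x ^ 2 := h1
      _ ≤ 2 * w x ^ 2 * M + 2 * L ^ 2 * w x ^ 2 := by
          have := mul_le_mul_of_nonneg_left h2 (by positivity : (0 : ℝ) ≤ 2 * w x ^ 2)
          have := mul_le_mul_of_nonneg_left h3 (by positivity : (0 : ℝ) ≤ 2 * L ^ 2)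
          linarith
      _ = (2 * M + 2 * L ^ 2) * w x ^ 2 := by ring
  -- integrability of the cut-off integrands (continuous, compact support)
  have hχc := hχ.continuous
  have I1 : Integrable fun x => χ x ^ 2 * F x ^ 2 := by
    have := (hχ.mul_contDiff hF).integrable_sq
    exact this.congr (Eventually.of_forall fun x => by simp [hχ_def, mul_pow])
  have I2 : Integrable fun x => χ x ^ 2 * (F x * r x) :=
    ((hχc.pow 2).mul (hF.continuous.mul hr)).integrable_of_hasCompactSupport hχ.hasCompactSupport_sq.mul_right
  have hgradχc : Continuous fun x => ‖gradient χ x‖ ^ 2 := by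
    have e : (fun x => ‖gradient χ x‖ ^ 2) = fun x => ∑ q, (pderiv q χ x) ^ 2 := by funext x; exact norm_gradient_sq χ x
    rw [e]; exact continuous_finsetSum _ fun q _ => (hχ.continuous_pderiv q).pow 2
  have hgradχs : HasCompactSupport fun x => ‖gradient χ x‖ ^ 2 := by
    refine HasCompactSupport.intro hχ.2 fun x hx => ?_
    simp [norm_gradient_sq, pderiv_eq_zero_of_notMem_tsupport hx]
  have I3 : Integrable fun x => ‖gradient χ x‖ ^ 2 * F x ^ 2 :=
    (hgradχc.mul (hF.continuous.pow 2)).integrable_of_hasCompactSupport hgradχs.mul_right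
  -- bounds of the three right-hand terms by `A`, `B`
  have hb1 : E * ∫ x, χ x ^ 2 * F x ^ 2 ≤ |E| * A := by
    have h0 : 0 ≤ ∫ x, χ x ^ 2 * F x ^ 2 := integral_nonneg fun x => by positivity
    have h1 : ∫ x, χ x ^ 2 * F x ^ 2 ≤ A :=
      integral_mono I1 hFw fun x => mul_le_mul_of_nonneg_right (hχsq x) (sq_nonneg _)
    calc E * ∫ x, χ x ^ 2 * F x ^ 2 ≤ |E| * ∫ x, χ x ^ 2 * F x ^ 2 := mul_le_mul_of_nonneg_right (le_abs_self E) h0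
      _ ≤ |E| * A := mul_le_mul_of_nonneg_left h1 (abs_nonneg E)
  have hb2 : ∫ x, χ x ^ 2 * (F x * r x) ≤ (1 / 2 : ℝ) * A + (1 / 2 : ℝ) * B := by
    have Isum : Integrable fun x => (1 / 2 : ℝ) * (w x ^ 2 * F x ^ 2) + (1 / 2 : ℝ) * (w x ^ 2 * r x ^ 2) :=
      (hFw.const_mul _).add (hrw.const_mul _)
    have h1 : ∫ x, χ x ^ 2 * (F x * r x) ≤ ∫ x, ((1 / 2 : ℝ) * (w x ^ 2 * F x ^ 2) + (1 / 2 : ℝ) * (w x ^ 2 * r x ^ 2)) := by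
      refine integral_mono I2 Isum fun x => ?_
      have h3 := hχsq x
      have : χ x ^ 2 * (F x * r x) ≤ χ x ^ 2 * ((1 / 2 : ℝ) * (F x ^ 2 + r x ^ 2)) := by
        apply mul_le_mul_of_nonneg_left _ (sq_nonneg _)
        nlinarith [sq_nonneg (F x - r x)]
      nlinarith [sq_nonneg (F x), sq_nonneg (r x)]
    rw [integral_add (hFw.const_mul _) (hrw.const_mul _), integral_const_mul, integral_const_mul] at h1
    exact h1
  have hb3 : ∫ x, ‖gradient χ x‖ ^ 2 * F x ^ 2 ≤ (2 * M + 2 * L ^ 2) * A := by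
    have h1 : ∫ x, ‖gradient χ x‖ ^ 2 * F x ^ 2 ≤ ∫ x, (2 * M + 2 * L ^ 2) * (w x ^ 2 * F x ^ 2) := by
      refine integral_mono I3 (hFw.const_mul _) fun x => ?_
      have := mul_le_mul_of_nonneg_right (hgradχ x) (sq_nonneg (F x))
      linarith
    rw [integral_const_mul] at h1
    exact h1
  have hmain : ∫ x, χ x ^ 2 * ‖gradient F x‖ ^ 2 ≤ K := by
    rw [hK_def]
    have hL2 : 0 ≤ L ^ 2 := sq_nonneg L
    nlinarith [hcac, hb1, hb2, hb3, abs_nonneg E]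
  -- on the ball, `w²(∂_pF)² ≤ χ² ‖∇F‖²`
  have hgradFc : Continuous fun x => ‖gradient F x‖ ^ 2 := by
    have e : (fun x => ‖gradient F x‖ ^ 2) = fun x => ∑ q, (pderiv q F x) ^ 2 := by funext x; exact norm_gradient_sq F x
    rw [e]; exact continuous_finsetSum _ fun q _ => (continuous_pderiv_of_contDiff_two hF q).pow 2
  have IA : Integrable fun x => χ x ^ 2 * ‖gradient F x‖ ^ 2 :=
    ((hχc.pow 2).mul hgradFc).integrable_of_hasCompactSupport hχ.hasCompactSupport_sq.mul_right
  have hball : ∫ x in ball (0 : ZM) R, w x ^ 2 * pderiv p F x ^ 2 ≤ ∫ x in ball (0 : ZM) R, χ x ^ 2 * ‖gradient F x‖ ^ 2 := by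
    refine setIntegral_mono_on
      ((hgc.continuousOn.integrableOn_compact (isCompact_closedBall (0 : ZM) R)).mono_set ball_subset_closedBall)
      IA.integrableOn measurableSet_ball fun x hx => ?_
    · rw [mem_ball_zero_iff] at hx
      have hχx : χ x = w x := hχeq x hx
      rw [← hχx, norm_gradient_sq]
      apply mul_le_mul_of_nonneg_left _ (sq_nonneg _)
      exact Finset.single_le_sum (f := fun q => (pderiv q F x) ^ 2) (fun q _ => sq_nonneg _) (Finset.mem_univ p)
  have hball2 : ∫ x in ball (0 : ZM) R, χ x ^ 2 * ‖gradient F x‖ ^ 2 ≤ ∫ x, χ x ^ 2 * ‖gradient F x‖ ^ 2 :=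
    setIntegral_le_integral IA (ae_of_all _ fun x => by positivity)
  exact (hball.trans hball2).trans hmain

end Propagate

end Literature.Analysis.OperatorTheory.YMMatrixModel

end
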